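import Mathlib.NumberTheory.NumberField.InfinitePlace.TotallyRealComplex
import Mathlib.RingTheory.Ideal.Over
import Literature.NumberTheory.GaloisRepresentations.ArtinRestriction
import Literature.NumberTheory.GaloisRepresentations.DihedralTypeMonomialAnyChar
import Literature.NumberTheory.GaloisRepresentations.SolvableDihedralCharTwo
import HarnessLib

/-!
# The residual quadratic field of a dihedral-type representation and Allen's condition (5)

Topic `Literature/NumberTheory/GaloisRepresentations` (companion of `ProjectiveType`,
`DihedralTypeMonomial(AnyChar)`, `ArtinRestriction`, `SolvableDihedralCharTwo`).

Informal content.  Let `ρ̄ : Γ_K → GL₂(k)` be a representation of **dihedral type**: its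
projective image `\bar ρ̄(Γ_K) ≤ PGL₂(k)` is isomorphic to a dihedral group `D_m`, `m ≥ 2`
(`Literature.NumberTheory.GaloisRepresentations.IsDihedralType`).  The inverse image
`H ≤ Γ_K` of the rotation subgroup `C_m ◁ D_m` has index `2`, and `ρ̄(H)` is commutative (every
`ρ̄(h)`, `h ∈ H`, is a scalar multiple of a power of a fixed lift of the generating rotation), so
`ρ̄|_H ≅ χ̄₁ ⊕ χ̄₂` and `ρ̄ ≅ Ind_H^{Γ_K} χ̄₁`
(`exists_monomial_of_isDihedralType_of_not_hasCommonEigenvector`).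
The fixed field `L = K̄^H` is the **quadratic field cut out by the rotations**; in P. Allen,
*Modularity of nearly ordinary 2-adic residually dihedral Galois representations*, Compositio
Math. 150 (2014), Theorem of the Introduction, hypothesis (5), it appears as "letting `L/F`
denote the unique quadratic extension such that `ρ̄|_{G_L}` is abelian, if `L/F` is CM, then
there is some `v ∣ 2` in `F` that does not split in `L`", with the remark "the extension `L/F`
in assumption (5) is unique since any absolutely irreducible, `2`-dimensional, mod `2`
representation with solvable image is dihedral … and the image of a mod `2` dihedral
representation has order not divisible by `4`".  Uniqueness indeed holds exactly when `m ≥ 3`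
(`|\bar ρ̄(Γ_K)| > 4`): for `m = 2` (projective image the Klein four-group, e.g. the
two-dimensional representation of the quaternion group) all three quadratic subfields of the
biquadratic field cut out by `\bar ρ̄` have this property, and the definition below picks the
one attached to a chosen isomorphism `\bar ρ̄(Γ_K) ≃ D_2`.

## Contents (everything stated is proved; two definitions and one predicate are introduced)

* `toProjectiveImage ρ : G →* projectiveImage ρ`; for `h : IsDihedralType ρ` a CHOSEN dihedral
  structure `h.degree = m`, `h.mulEquiv : projectiveImage ρ ≃* DihedralGroup m`,
  `h.toDihedral : G →* DihedralGroup m` (surjective), `h.card_projectiveImage : |\bar ρ(G)| = 2m`.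
* `dihedralRotationSubgroup ρ : Subgroup G` — the inverse image of the rotations `⟨r⟩ ◁ D_m`
  (junk value `⊤` when `ρ` is not of dihedral type): index `2`, normal, contains `ker ρ`, and
  `ρ x`, `ρ y` commute for `x, y` in it (`IsDihedralType.commute_of_mem_dihedralRotationSubgroup`).
* **Uniqueness** (`eq_of_index_two_of_forall_commute`,
  `IsDihedralType.eq_dihedralRotationSubgroup`): for `k` algebraically closed (any characteristic),
  `ρ : G →* GL₂(k)` with finite image, no common eigenvector, of dihedral type with
  `|\bar ρ(G)| > 4`, an index-two subgroup on which `ρ` has commutative image IS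
  `dihedralRotationSubgroup ρ`; in characteristic `2` the hypothesis `|\bar ρ(G)| > 4` is
  automatic (`IsDihedralType.four_lt_card_projectiveImage_of_charTwo`: a Klein four projective
  image consists of commuting involutions, which have a common eigenvector in characteristic `2`,
  `CharTwoPGL2.hasCommonEigenvector_of_involutions`) — this is the uniqueness asserted by Allen.
* `residualQuadraticField ρ̄ : IntermediateField K (AlgebraicClosure K)` for
  `ρ̄ : Γ_K →* GL_n(R)` — the fixed field `K̄^H` of `H = dihedralRotationSubgroup ρ̄`; for `K` of
  characteristic `0`, `ρ̄` of dihedral type with open kernel: `[L : K] = 2`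
  (`finrank_residualQuadraticField`), `Gal(K̄/L) = H` (`fixingSubgroup_residualQuadraticField`),
  `ρ̄(Gal(K̄/L))` commutative (`commute_of_mem_fixingSubgroup_residualQuadraticField`, and along
  the tree's restriction map `Γ_L → Γ_K`, `commute_absGaloisRestrict_residualQuadraticField`),
  and it is the unique quadratic `L' ⊆ K̄` with `ρ̄(Gal(K̄/L'))` commutative
  (`eq_residualQuadraticField`, `eq_residualQuadraticField_of_charTwo`).
* `AllenConditionFive ρ̄` — Allen's hypothesis (5) for a number field `K`: if
  `L = residualQuadraticField ρ̄` is totally complex ("`L/F` is CM", `F` being totally real in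
  Allen's theorem) then some place `v ∣ 2` of `K` does not split in `L` (at most one prime of
  `𝓞_L` lies over `v`).

## Mathlib / tree search

Mathlib (this pin): `DihedralGroup` (`r`, `sr`, `r_one_zpow`, `orderOf_r_one`, `nat_card`),
`Matrix.ProjGenLinGroup.mk_eq_mk_iff'`, `Subgroup.index_comap_of_surjective`, `index_ker`,
`index_inf_le`, `relIndex_mul_index`, infinite Galois theory
(`InfiniteGalois.fixedField_fixingSubgroup`, `IntermediateField.finrank_eq_fixingSubgroup_index`),
`NumberField.IsTotallyComplex`, `Ideal.primesOver`; no notion of the field cut out by a subgroup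
of a projective image (`lean search residualQuadraticField|dihedralRotation|rotationSubgroup`:
nothing).  Tree: `projectiveImage`, `IsDihedralType` (`ProjectiveType`), the fixed-field /
open-subgroup dictionary `fixingSubgroup_fixedField_of_isOpen`, `finrank_fixedField_of_isOpen`,
`exists_mem_range_absGaloisRestrict_fixedField_iff` (`ArtinRestriction`), the monomial structure
theorem `exists_monomial_of_isDihedralType_of_not_hasCommonEigenvector`
(`DihedralTypeMonomialAnyChar`, whose index-two subgroup is constructed inside a proof and not
named), `CharTwoPGL2.hasCommonEigenvector_of_involutions` (`SolvableDihedralCharTwo`),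
`GL2.IsDg/IsAd`, `conjGL`, `HasCommonEigenvector` (`ProjectiveTypeSolvable`).  Nothing is
re-declared.

## References

* [Allen2014] P. B. Allen, *Modularity of nearly ordinary 2-adic residually dihedral Galois
  representations*, Compositio Math. 150 (2014), 1235–1346, Introduction, Theorem, hypothesis
  (5) and the paragraph preceding the Theorem (uniqueness of `L/F`); arXiv:1301.1113, p. 2.
* [Gelbart1997] S. Gelbart, *Three lectures on the modularity of `ρ̄_{E,3}` …*, in *Modular
  Forms and Fermat's Last Theorem* (1997), §4.3, Proposition (ii) (dihedral type = induced from
  a quadratic extension).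
* [KhareWintenberger2009] C. Khare, J.-P. Wintenberger, *Serre's modularity conjecture (I)*,
  Invent. Math. 178 (2009), §6, proof of Lemma 6.3 (i) ("`ρ̄` is induced from `G_K` with `K` a
  quadratic extension of `ℚ`").
-/

noncomputable section

open Matrix Subgroup Field
open scoped MatrixGroups NumberField

namespace Literature.NumberTheory.GaloisRepresentations

/-! ### `G → \bar ρ(G)` and the chosen dihedral structure -/

section Structure

variable {G : Type*} [Group G] {n : Type*} [Fintype n] [DecidableEq n] {R : Type*} [CommRing R]

/-- The surjection `G → \bar ρ(G)` of `G` onto the projective image of `ρ : G → GL_n(R)`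
(`g ↦` the class of `ρ(g)` in `PGL_n(R)`; Mathlib `MonoidHom.rangeRestrict`). [folklore] -/
def toProjectiveImage (ρ : G →* GL n R) : G →* projectiveImage ρ :=
  (Matrix.ProjGenLinGroup.mk.comp ρ).rangeRestrict

/-- Unfolding lemma for `toProjectiveImage`. [folklore] -/
@[simp] theorem coe_toProjectiveImage_apply (ρ : G →* GL n R) (g : G) :
    ((toProjectiveImage ρ g : projectiveImage ρ) : PGL(n, R)) =
      Matrix.ProjGenLinGroup.mk (ρ g) :=
  rfl

/-- `G → \bar ρ(G)` is surjective. [folklore] -/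
theorem toProjectiveImage_surjective (ρ : G →* GL n R) :
    Function.Surjective (toProjectiveImage ρ) :=
  MonoidHom.rangeRestrict_surjective _

/-- `g` dies in `\bar ρ(G)` iff `ρ(g)` is central (scalar). [folklore] -/
theorem toProjectiveImage_eq_one_iff (ρ : G →* GL n R) {g : G} :
    toProjectiveImage ρ g = 1 ↔ ρ g ∈ center (GL n R) := by
  rw [Subtype.ext_iff, coe_toProjectiveImage_apply, OneMemClass.coe_one,
    Matrix.ProjGenLinGroup.mk_eq_one]

/-- `g, g'` have the same image in `\bar ρ(G)` iff `ρ(g) z = ρ(g')` for a central `z`.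
[folklore] -/
theorem toProjectiveImage_eq_iff (ρ : G →* GL n R) {g g' : G} :
    toProjectiveImage ρ g = toProjectiveImage ρ g' ↔
      ∃ z ∈ center (GL n R), ρ g * z = ρ g' := by
  rw [Subtype.ext_iff, coe_toProjectiveImage_apply, coe_toProjectiveImage_apply,
    Matrix.ProjGenLinGroup.mk_eq_mk_iff']

/-- The kernel of `G → \bar ρ(G)` is that of `G → GL_n(R) → PGL_n(R)`. [folklore] -/
theorem ker_toProjectiveImage (ρ : G →* GL n R) :
    (toProjectiveImage ρ).ker = (Matrix.ProjGenLinGroup.mk.comp ρ).ker :=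
  MonoidHom.ker_rangeRestrict _

variable {ρ : G →* GL n R}

namespace IsDihedralType

/-- The `m ≥ 2` of a CHOSEN isomorphism `\bar ρ(G) ≃ D_m` for `ρ` of dihedral type
(`Classical.choose`; of course `2m = |\bar ρ(G)|`, `card_projectiveImage`, so `m` does not
depend on the choice). [folklore] -/
def degree (h : IsDihedralType ρ) : ℕ :=
  Exists.choose h

/-- `m ≥ 2`. [folklore] -/
theorem two_le_degree (h : IsDihedralType ρ) : 2 ≤ h.degree :=
  (Exists.choose_spec h).1

/-- The CHOSEN isomorphism `\bar ρ(G) ≃ D_m` (`Classical.choice`). [folklore] -/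
def mulEquiv (h : IsDihedralType ρ) : projectiveImage ρ ≃* DihedralGroup h.degree :=
  Classical.choice (Exists.choose_spec h).2

/-- `|\bar ρ(G)| = 2m`. [folklore] -/
theorem card_projectiveImage (h : IsDihedralType ρ) :
    Nat.card (projectiveImage ρ) = 2 * h.degree := by
  rw [Nat.card_congr h.mulEquiv.toEquiv, DihedralGroup.nat_card]

/-- The projective image of a dihedral-type representation is finite. [folklore] -/
theorem finite_projectiveImage (h : IsDihedralType ρ) : Finite (projectiveImage ρ) := by
  haveI : NeZero h.degree := ⟨by have := h.two_le_degree; omega⟩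
  exact Finite.of_equiv _ h.mulEquiv.symm.toEquiv

/-- `|\bar ρ(G)| > 4` iff `m ≥ 3` (iff `\bar ρ(G) ≅ D_m` is non-commutative). [folklore] -/
theorem four_lt_card_projectiveImage_iff (h : IsDihedralType ρ) :
    4 < Nat.card (projectiveImage ρ) ↔ 3 ≤ h.degree := by
  rw [h.card_projectiveImage]
  omega

/-- The surjection `G → \bar ρ(G) ≃ D_m`. [folklore] -/
def toDihedral (h : IsDihedralType ρ) : G →* DihedralGroup h.degree :=
  h.mulEquiv.toMonoidHom.comp (toProjectiveImage ρ)

/-- Unfolding lemma for `toDihedral`. [folklore] -/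
theorem toDihedral_apply (h : IsDihedralType ρ) (g : G) :
    h.toDihedral g = h.mulEquiv (toProjectiveImage ρ g) :=
  rfl

/-- `G → D_m` is surjective. [folklore] -/
theorem toDihedral_surjective (h : IsDihedralType ρ) : Function.Surjective h.toDihedral :=
  h.mulEquiv.surjective.comp (toProjectiveImage_surjective ρ)

/-- `g` dies in `D_m` iff `ρ(g)` is central. [folklore] -/
theorem toDihedral_eq_one_iff (h : IsDihedralType ρ) {g : G} :
    h.toDihedral g = 1 ↔ ρ g ∈ center (GL n R) := by
  rw [toDihedral_apply, MulEquiv.map_eq_one_iff, toProjectiveImage_eq_one_iff]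

end IsDihedralType

/-! ### The rotation subgroup `⟨r⟩ ◁ D_m` -/

/-- The rotations `r i` are exactly the elements of `⟨r 1⟩ ≤ D_m`. [folklore] -/
theorem mem_zpowers_r_one_iff {m : ℕ} (x : DihedralGroup m) :
    x ∈ zpowers (DihedralGroup.r 1 : DihedralGroup m) ↔
      ∃ i : ZMod m, x = DihedralGroup.r i := by
  rw [mem_zpowers_iff]
  constructor
  · rintro ⟨j, rfl⟩
    exact ⟨j, DihedralGroup.r_one_zpow j⟩
  · rintro ⟨i, rfl⟩
    exact ⟨(i.cast : ℤ), by rw [DihedralGroup.r_one_zpow, ZMod.intCast_zmod_cast]⟩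

/-- Reflections are not rotations. [folklore] -/
theorem sr_not_mem_zpowers_r_one {m : ℕ} (i : ZMod m) :
    DihedralGroup.sr i ∉ zpowers (DihedralGroup.r 1 : DihedralGroup m) := by
  rw [mem_zpowers_r_one_iff]
  rintro ⟨j, hj⟩
  cases hj

/-- The rotation subgroup `⟨r⟩ ≤ D_m` (`m ≠ 0`) has index `2`. [folklore] -/
theorem index_zpowers_r_one {m : ℕ} (hm : m ≠ 0) :
    (zpowers (DihedralGroup.r 1 : DihedralGroup m)).index = 2 := by
  have h1 := (zpowers (DihedralGroup.r 1 : DihedralGroup m)).card_mul_index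
  rw [Nat.card_zpowers, DihedralGroup.orderOf_r_one, DihedralGroup.nat_card, mul_comm 2 m] at h1
  exact Nat.eq_of_mul_eq_mul_left (Nat.pos_of_ne_zero hm) h1

/-! ### The inverse image of the rotations -/

open Classical in
/-- **The index-two subgroup of a dihedral-type representation.**  For `ρ : G → GL_n(R)` of
dihedral type, the inverse image in `G` of the rotation subgroup `C_m = ⟨r⟩ ◁ D_m` under
`G → \bar ρ(G) ≃ D_m` (for the chosen isomorphism `IsDihedralType.mulEquiv`; for `m ≥ 3` the
subgroup does not depend on the choice, `IsDihedralType.eq_dihedralRotationSubgroup`).  It has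
index `2`, contains `ker ρ`, and `ρ` restricted to it has commutative image — for `G = Γ_K` it is
`Γ_L` for the quadratic field `L` from which `ρ` is induced (Gelbart 1997, §4.3, Prop. (ii);
Khare–Wintenberger 2009, proof of Lemma 6.3 (i); Allen 2014, Theorem, (5)).  Junk value `⊤`
when `ρ` is not of dihedral type. [cite: Allen2014, Introduction, Theorem, hypothesis (5)] -/
def dihedralRotationSubgroup (ρ : G →* GL n R) : Subgroup G :=
  if h : IsDihedralType ρ then
    (zpowers (DihedralGroup.r 1 : DihedralGroup h.degree)).comap h.toDihedral
  else ⊤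

/-- Junk case of `dihedralRotationSubgroup`. [folklore] -/
theorem dihedralRotationSubgroup_of_not_isDihedralType (h : ¬ IsDihedralType ρ) :
    dihedralRotationSubgroup ρ = ⊤ := by
  rw [dihedralRotationSubgroup, dif_neg h]

namespace IsDihedralType

/-- For `ρ` of dihedral type, `dihedralRotationSubgroup ρ` is the inverse image of `⟨r⟩`.
[folklore] -/
theorem dihedralRotationSubgroup_eq (h : IsDihedralType ρ) :
    dihedralRotationSubgroup ρ =
      (zpowers (DihedralGroup.r 1 : DihedralGroup h.degree)).comap h.toDihedral := by
  rw [dihedralRotationSubgroup, dif_pos h]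

/-- Membership in `dihedralRotationSubgroup ρ`: `g` maps to a rotation. [folklore] -/
theorem mem_dihedralRotationSubgroup_iff (h : IsDihedralType ρ) {g : G} :
    g ∈ dihedralRotationSubgroup ρ ↔
      ∃ i : ZMod h.degree, h.toDihedral g = DihedralGroup.r i := by
  rw [h.dihedralRotationSubgroup_eq, mem_comap, mem_zpowers_r_one_iff]

/-- Non-membership in `dihedralRotationSubgroup ρ`: `g` maps to a reflection. [folklore] -/
theorem not_mem_dihedralRotationSubgroup_iff (h : IsDihedralType ρ) {g : G} :
    g ∉ dihedralRotationSubgroup ρ ↔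
      ∃ i : ZMod h.degree, h.toDihedral g = DihedralGroup.sr i := by
  rw [h.mem_dihedralRotationSubgroup_iff]
  constructor
  · intro hg
    rcases hx : h.toDihedral g with i | i
    · exact absurd ⟨i, hx⟩ hg
    · exact ⟨i, rfl⟩
  · rintro ⟨i, hi⟩ ⟨j, hj⟩
    rw [hi] at hj
    cases hj

/-- **`dihedralRotationSubgroup ρ` has index `2`.** [folklore] -/
theorem index_dihedralRotationSubgroup (h : IsDihedralType ρ) :
    (dihedralRotationSubgroup ρ).index = 2 := by
  rw [h.dihedralRotationSubgroup_eq, index_comap_of_surjective _ h.toDihedral_surjective,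
    index_zpowers_r_one (by have := h.two_le_degree; omega)]

/-- `dihedralRotationSubgroup ρ` is normal. [folklore] -/
theorem normal_dihedralRotationSubgroup (h : IsDihedralType ρ) :
    (dihedralRotationSubgroup ρ).Normal :=
  normal_of_index_eq_two h.index_dihedralRotationSubgroup

/-- A lift `h₀ ∈ G` of the generating rotation `r 1`; it lies in `dihedralRotationSubgroup ρ`
and `ρ(h₀)` is not central. [folklore] -/
theorem exists_toDihedral_eq_r_one (h : IsDihedralType ρ) :
    ∃ h₀ : G, h.toDihedral h₀ = DihedralGroup.r 1 ∧ h₀ ∈ dihedralRotationSubgroup ρ ∧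
      ρ h₀ ∉ center (GL n R) := by
  obtain ⟨h₀, hh₀⟩ := h.toDihedral_surjective (DihedralGroup.r 1)
  refine ⟨h₀, hh₀, h.mem_dihedralRotationSubgroup_iff.mpr ⟨1, hh₀⟩, fun hc => ?_⟩
  haveI : Fact (1 < h.degree) := ⟨by have := h.two_le_degree; omega⟩
  rw [← h.toDihedral_eq_one_iff, hh₀, DihedralGroup.one_def] at hc
  exact one_ne_zero (DihedralGroup.r.inj hc)

/-- Elements of `dihedralRotationSubgroup ρ` are, under `ρ`, central multiples of powers of
`ρ(h₀)` for any lift `h₀` of the generating rotation. [folklore] -/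
theorem exists_eq_zpow_mul_of_mem (h : IsDihedralType ρ) {h₀ : G}
    (hh₀ : h.toDihedral h₀ = DihedralGroup.r 1) {g : G}
    (hg : g ∈ dihedralRotationSubgroup ρ) :
    ∃ (i : ℤ) (z : GL n R), z ∈ center (GL n R) ∧ ρ g = ρ h₀ ^ i * z := by
  rw [h.mem_dihedralRotationSubgroup_iff] at hg
  obtain ⟨i, hi⟩ := hg
  have h1 : h.toDihedral (h₀ ^ (i.cast : ℤ)) = h.toDihedral g := by
    rw [map_zpow, hh₀, DihedralGroup.r_one_zpow, ZMod.intCast_zmod_cast, hi]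
  have h2 : toProjectiveImage ρ (h₀ ^ (i.cast : ℤ)) = toProjectiveImage ρ g :=
    h.mulEquiv.injective h1
  rw [toProjectiveImage_eq_iff] at h2
  obtain ⟨z, hz, hzg⟩ := h2
  exact ⟨i.cast, z, hz, by rw [← hzg, map_zpow]⟩

/-- **`ρ` has commutative image on `dihedralRotationSubgroup ρ`** ("`ρ̄|_{G_L}` is abelian",
Allen 2014, (5)): both `ρ x` and `ρ y` are central multiples of powers of one `ρ(h₀)`.
[cite: Allen2014, Introduction, Theorem, hypothesis (5)] -/
theorem commute_of_mem_dihedralRotationSubgroup (h : IsDihedralType ρ) {x y : G}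
    (hx : x ∈ dihedralRotationSubgroup ρ) (hy : y ∈ dihedralRotationSubgroup ρ) :
    Commute (ρ x) (ρ y) := by
  obtain ⟨h₀, hh₀, -, -⟩ := h.exists_toDihedral_eq_r_one
  obtain ⟨i, z, hz, hxz⟩ := h.exists_eq_zpow_mul_of_mem hh₀ hx
  obtain ⟨j, w, hw, hyw⟩ := h.exists_eq_zpow_mul_of_mem hh₀ hy
  rw [hxz, hyw]
  have hzc : ∀ a, Commute z a := fun a => (mem_center_iff.mp hz a).symm
  have hwc : ∀ a, Commute w a := fun a => (mem_center_iff.mp hw a).symm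
  exact ((Commute.zpow_zpow_self (ρ h₀) i j).mul_right (hwc _).symm).mul_left (hzc _)

end IsDihedralType

/-- The kernel of `G → PGL_n(R)` lies in `dihedralRotationSubgroup ρ`. [folklore] -/
theorem mem_dihedralRotationSubgroup_of_apply_mem_center (ρ : G →* GL n R) {g : G}
    (hg : ρ g ∈ center (GL n R)) : g ∈ dihedralRotationSubgroup ρ := by
  by_cases h : IsDihedralType ρ
  · rw [h.mem_dihedralRotationSubgroup_iff]
    refine ⟨0, ?_⟩
    rw [← DihedralGroup.one_def, h.toDihedral_eq_one_iff]
    exact hg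
  · rw [dihedralRotationSubgroup_of_not_isDihedralType h]
    exact mem_top g

/-- `ker (G → PGL_n(R)) ≤ dihedralRotationSubgroup ρ`. [folklore] -/
theorem ker_mk_comp_le_dihedralRotationSubgroup (ρ : G →* GL n R) :
    (Matrix.ProjGenLinGroup.mk.comp ρ).ker ≤ dihedralRotationSubgroup ρ := fun _ hg =>
  mem_dihedralRotationSubgroup_of_apply_mem_center ρ
    (Matrix.ProjGenLinGroup.mk_eq_one.mp (MonoidHom.mem_ker.mp hg))

/-- `ker ρ ≤ dihedralRotationSubgroup ρ`. [folklore] -/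
theorem ker_le_dihedralRotationSubgroup (ρ : G →* GL n R) :
    ρ.ker ≤ dihedralRotationSubgroup ρ := fun _ hg =>
  mem_dihedralRotationSubgroup_of_apply_mem_center ρ
    (by rw [MonoidHom.mem_ker.mp hg]; exact one_mem _)

/-- If `ker ρ` is open (e.g. `ρ` continuous for the discrete topology on `GL_n(R)`), so is
`dihedralRotationSubgroup ρ`. [folklore] -/
theorem isOpen_dihedralRotationSubgroup [TopologicalSpace G] [IsTopologicalGroup G]
    (ρ : G →* GL n R) (hker : IsOpen (ρ.ker : Set G)) :
    IsOpen (dihedralRotationSubgroup ρ : Set G) :=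
  Subgroup.isOpen_mono (ker_le_dihedralRotationSubgroup ρ) hker

end Structure

/-! ### Uniqueness of the index-two subgroup with commutative image (`m ≥ 3`) -/

section Unique

variable {G : Type*} [Group G] {k : Type*} [Field k]

/-- A diagonal `2 × 2` matrix commuting with an antidiagonal one with non-zero upper-right
entry is scalar. [folklore] -/
theorem GL2.apply_zero_zero_eq_of_isDg_of_isAd {d a : Matrix (Fin 2) (Fin 2) k} (hd : GL2.IsDg d)
    (ha : GL2.IsAd a) (ha01 : a 0 1 ≠ 0) (h : d * a = a * d) : d 0 0 = d 1 1 := by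
  have h01 := congrFun (congrFun h 0) 1
  simp only [Matrix.mul_apply, Fin.sum_univ_two, hd.1, ha.1, ha.2, mul_zero, add_zero,
    zero_add] at h01
  exact mul_right_cancel₀ ha01 (h01.trans (mul_comm _ _))

/-- **At most one index-two subgroup carries a commutative image when `|\bar ρ(G)| > 4`.**
Let `k` be algebraically closed (any characteristic), `ρ : G → GL₂(k)` with finite image, no
common eigenvector, of dihedral type with `|\bar ρ(G)| > 4` (i.e. `\bar ρ(G) ≅ D_m`, `m ≥ 3`).
If `H₁, H₂ ≤ G` have index `2` and `ρ(H₁)`, `ρ(H₂)` are commutative then `H₁ = H₂`.  Proof: in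
the monomial basis of `exists_monomial_of_isDihedralType_of_not_hasCommonEigenvector` (`ρ`
diagonal on an index-two `H`, antidiagonal off `H`), if `H' ≠ H` then some `x ∈ H' ∖ H` is
antidiagonal and every `g ∈ H ∩ H'` is diagonal and commutes with it, hence scalar; so
`G → \bar ρ(G)` kills `H ∩ H'`, of index `≤ 4`, forcing `|\bar ρ(G)| ≤ 4`.  (Allen 2014: "the
extension `L/F` in assumption (5) is unique".)
[cite: Allen2014, Introduction, paragraph before the Theorem] -/
theorem eq_of_index_two_of_forall_commute [IsAlgClosed k] (ρ : G →* GL (Fin 2) k)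
    [Finite ρ.range] (hce : ¬ HasCommonEigenvector ρ) (hρ : IsDihedralType ρ)
    (h4 : 4 < Nat.card (projectiveImage ρ)) {H₁ H₂ : Subgroup G}
    (h₁ : H₁.index = 2) (hc₁ : ∀ x ∈ H₁, ∀ y ∈ H₁, Commute (ρ x) (ρ y))
    (h₂ : H₂.index = 2) (hc₂ : ∀ x ∈ H₂, ∀ y ∈ H₂, Commute (ρ x) (ρ y)) :
    H₁ = H₂ := by
  obtain ⟨H, P, hH, hDg, hAd, -⟩ :=
    exists_monomial_of_isDihedralType_of_not_hasCommonEigenvector ρ hce hρ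
  -- every index-two subgroup with commutative image is `H`
  suffices key : ∀ H' : Subgroup G, H'.index = 2 →
      (∀ x ∈ H', ∀ y ∈ H', Commute (ρ x) (ρ y)) → H' = H by
    rw [key H₁ h₁ hc₁, key H₂ h₂ hc₂]
  intro H' hH' hc'
  by_contra hne
  -- some `x ∈ H' ∖ H`, necessarily antidiagonal
  have hnle : ¬ H' ≤ H := by
    intro hle
    apply hne
    refine le_antisymm hle (relIndex_eq_one.mp ?_)
    have h1 := relIndex_mul_index hle
    rw [hH, hH'] at h1
    omega
  obtain ⟨x, hxH', hxH⟩ := SetLike.not_le_iff_exists.mp hnle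
  have hxAd := hAd x hxH
  have hx01 : ((conjGL P ρ x : GL (Fin 2) k) : Matrix (Fin 2) (Fin 2) k) 0 1 ≠ 0 :=
    (hxAd.entry_ne_zero (GL2.det_ne_zero _)).1
  -- `H ⊓ H'` is killed by `G → \bar ρ(G)`
  have hker : H ⊓ H' ≤ (Matrix.ProjGenLinGroup.mk.comp ρ).ker := by
    intro g hg
    obtain ⟨hgH, hgH'⟩ := mem_inf.mp hg
    have hgDg := hDg g hgH
    have hcomm :
        ((conjGL P ρ g : GL (Fin 2) k) : Matrix (Fin 2) (Fin 2) k) * (conjGL P ρ x : GL (Fin 2) k) =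
          ((conjGL P ρ x : GL (Fin 2) k) : Matrix (Fin 2) (Fin 2) k) *
            (conjGL P ρ g : GL (Fin 2) k) := by
      rw [← Matrix.GeneralLinearGroup.coe_mul, ← Matrix.GeneralLinearGroup.coe_mul]
      congr 1
      exact ((hc' g hgH' x hxH').map (MulAut.conj P).toMonoidHom).eq
    have h00 := GL2.apply_zero_zero_eq_of_isDg_of_isAd hgDg hxAd hx01 hcomm
    have hcen : conjGL P ρ g ∈ center (GL (Fin 2) k) :=
      GL2.mem_center_iff.mpr ⟨hgDg.1, hgDg.2, h00⟩
    rw [MonoidHom.mem_ker, MonoidHom.comp_apply, Matrix.ProjGenLinGroup.mk_eq_one]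
    have hg' : ρ g = P⁻¹ * conjGL P ρ g * P := by
      rw [conjGL_apply]
      group
    rw [hg', mem_center_iff.mp hcen P⁻¹, inv_mul_cancel_right]
    exact hcen
  -- so `|\bar ρ(G)| = [G : ker] ≤ [G : H ⊓ H'] ≤ 4`
  have hidx : (Matrix.ProjGenLinGroup.mk.comp ρ).ker.index ≤ 4 := by
    have h1 := index_dvd_of_le hker
    have h2 : (H ⊓ H').index ≤ H.index * H'.index := index_inf_le
    have h3 : (H ⊓ H').index ≠ 0 :=
      index_inf_ne_zero (by rw [hH]; decide) (by rw [hH']; decide)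
    rw [hH, hH'] at h2
    exact (Nat.le_of_dvd (Nat.pos_of_ne_zero h3) h1).trans h2
  rw [index_ker] at hidx
  exact absurd h4 (not_lt.mpr hidx)

namespace IsDihedralType

/-- **Uniqueness of `dihedralRotationSubgroup`** (`k` algebraically closed, any characteristic):
for `ρ : G → GL₂(k)` with finite image, no common eigenvector, of dihedral type with
`|\bar ρ(G)| > 4`, every index-two subgroup on which `ρ` has commutative image equals
`dihedralRotationSubgroup ρ`. [cite: Allen2014, Introduction, paragraph before the Theorem] -/
theorem eq_dihedralRotationSubgroup [IsAlgClosed k] {ρ : G →* GL (Fin 2) k} [Finite ρ.range]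
    (hρ : IsDihedralType ρ) (hce : ¬ HasCommonEigenvector ρ)
    (h4 : 4 < Nat.card (projectiveImage ρ)) {H' : Subgroup G} (hH' : H'.index = 2)
    (hc' : ∀ x ∈ H', ∀ y ∈ H', Commute (ρ x) (ρ y)) : H' = dihedralRotationSubgroup ρ :=
  eq_of_index_two_of_forall_commute ρ hce hρ h4 hH' hc' hρ.index_dihedralRotationSubgroup
    fun _ hx _ hy => hρ.commute_of_mem_dihedralRotationSubgroup hx hy

open Matrix.ProjGenLinGroup in
/-- **In characteristic `2` a dihedral projective image without common eigenvector has order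
`> 4`** (Allen 2014: "the image of a mod `2` dihedral representation has order not divisible by
`4`" — we record only what uniqueness needs): if `\bar ρ(G) ≅ D_2` were the Klein four-group, its
non-trivial elements would form a conjugation-stable family of pairwise commuting involutions,
which has a common eigenvector in characteristic `2`
(`CharTwoPGL2.hasCommonEigenvector_of_involutions`).
[cite: Allen2014, Introduction, paragraph before the Theorem] -/
theorem four_lt_card_projectiveImage_of_charTwo [IsAlgClosed k] [CharP k 2]
    {ρ : G →* GL (Fin 2) k} (hρ : IsDihedralType ρ) (hce : ¬ HasCommonEigenvector ρ) :
    4 < Nat.card (projectiveImage ρ) := by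
  rw [hρ.four_lt_card_projectiveImage_iff]
  by_contra hlt
  have hm : hρ.degree = 2 := by have := hρ.two_le_degree; omega
  apply hce
  -- `D_2` has exponent `2` and is commutative
  have hD : ∀ m : ℕ, m = 2 →
      (∀ y : DihedralGroup m, y * y = 1) ∧ ∀ y y' : DihedralGroup m, y * y' = y' * y := by
    rintro m rfl
    exact ⟨by decide, by decide⟩
  obtain ⟨hsq, hcomm⟩ := hD _ hm
  have hsq' : ∀ g : G, mk (ρ g) * mk (ρ g) = 1 := fun g => by
    have h1 : toProjectiveImage ρ g * toProjectiveImage ρ g = 1 :=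
      hρ.mulEquiv.injective (by rw [map_mul, map_one]; exact hsq _)
    exact congrArg Subtype.val h1
  have hcomm' : ∀ g g' : G, mk (ρ g) * mk (ρ g') = mk (ρ g') * mk (ρ g) := fun g g' => by
    have h1 : toProjectiveImage ρ g * toProjectiveImage ρ g' =
        toProjectiveImage ρ g' * toProjectiveImage ρ g :=
      hρ.mulEquiv.injective (by rw [map_mul, map_mul]; exact hcomm _ _)
    exact congrArg Subtype.val h1
  obtain ⟨h₀, -, -, hh₀⟩ := hρ.exists_toDihedral_eq_r_one
  refine CharTwoPGL2.hasCommonEigenvector_of_involutions ρ {g | mk (ρ g) ≠ 1}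
    ⟨h₀, fun h1 => hh₀ (Matrix.ProjGenLinGroup.mk_eq_one.mp h1)⟩
    (fun s hs => ⟨hs, hsq' s⟩) (fun s _ t _ => hcomm' s t) (fun g s hs h1 => hs ?_)
  simp only [map_mul, map_inv] at h1
  calc mk (ρ s)
      = mk (ρ g) * ((mk (ρ g))⁻¹ * mk (ρ s) * mk (ρ g)) * (mk (ρ g))⁻¹ := by group
    _ = 1 := by rw [h1]; group

/-- **Uniqueness of `dihedralRotationSubgroup` in characteristic `2`** (the uniqueness of the
quadratic field `L/F` asserted in Allen 2014): `k` algebraically closed of characteristic `2`,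
`ρ : G → GL₂(k)` with finite image, no common eigenvector, of dihedral type; then every
index-two subgroup on which `ρ` has commutative image is `dihedralRotationSubgroup ρ`.
[cite: Allen2014, Introduction, paragraph before the Theorem] -/
theorem eq_dihedralRotationSubgroup_of_charTwo [IsAlgClosed k] [CharP k 2]
    {ρ : G →* GL (Fin 2) k} [Finite ρ.range] (hρ : IsDihedralType ρ)
    (hce : ¬ HasCommonEigenvector ρ) {H' : Subgroup G} (hH' : H'.index = 2)
    (hc' : ∀ x ∈ H', ∀ y ∈ H', Commute (ρ x) (ρ y)) : H' = dihedralRotationSubgroup ρ :=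
  hρ.eq_dihedralRotationSubgroup hce (hρ.four_lt_card_projectiveImage_of_charTwo hce) hH' hc'

/-- In characteristic `0`, a dihedral-type representation with finite image has no common
eigenvector (a common eigenvector forces a cyclic projective image,
`isCyclicType_of_hasCommonEigenvector`). [folklore] -/
theorem not_hasCommonEigenvector [CharZero k] {ρ : G →* GL (Fin 2) k} [Finite ρ.range]
    (hρ : IsDihedralType ρ) : ¬ HasCommonEigenvector ρ := fun hev => by
  apply hρ.not_isCyclicType
  have hc : IsCyclicType ρ.range.subtype :=
    isCyclicType_of_hasCommonEigenvector ρ.range.subtype hev.range_subtype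
  unfold IsCyclicType at hc ⊢
  rwa [projectiveImage_range_subtype] at hc

/-- **Uniqueness of `dihedralRotationSubgroup` in characteristic `0`**: `k` algebraically
closed of characteristic `0`, `ρ : G → GL₂(k)` with finite image, of dihedral type with
`|\bar ρ(G)| > 4`; then every index-two subgroup on which `ρ` has commutative image is
`dihedralRotationSubgroup ρ`. [folklore] -/
theorem eq_dihedralRotationSubgroup_of_charZero [IsAlgClosed k] [CharZero k]
    {ρ : G →* GL (Fin 2) k} [Finite ρ.range] (hρ : IsDihedralType ρ)
    (h4 : 4 < Nat.card (projectiveImage ρ)) {H' : Subgroup G} (hH' : H'.index = 2)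
    (hc' : ∀ x ∈ H', ∀ y ∈ H', Commute (ρ x) (ρ y)) : H' = dihedralRotationSubgroup ρ :=
  hρ.eq_dihedralRotationSubgroup hρ.not_hasCommonEigenvector h4 hH' hc'

end IsDihedralType

end Unique

/-! ### The residual quadratic field -/

section ResidualField

variable {K : Type*} [Field K] {n : Type*} [Fintype n] [DecidableEq n] {R : Type*} [CommRing R]

/-- **The (residual) quadratic field of a dihedral-type representation** `ρ̄ : Γ_K → GL_n(R)`
(Allen 2014, Theorem, (5): "the unique quadratic extension `L/F` such that `ρ̄|_{G_L}` is
abelian"): the subfield `L = K̄^H ⊆ K̄` fixed by `H = dihedralRotationSubgroup ρ̄ ≤ Γ_K`, the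
inverse image of the rotations `C_m ◁ D_m ≅ \bar ρ̄(Γ_K)`.  For `K` of characteristic `0` and `ρ̄`
of dihedral type with open kernel: `[L : K] = 2` (`finrank_residualQuadraticField`),
`Gal(K̄/L) = H` (`fixingSubgroup_residualQuadraticField`), `ρ̄(Gal(K̄/L))` is commutative
(`commute_of_mem_fixingSubgroup_residualQuadraticField`) and, when `|\bar ρ̄(Γ_K)| > 4` (automatic
in characteristic `2`), `L` is the only quadratic subfield of `K̄` with this property
(`eq_residualQuadraticField`, `eq_residualQuadraticField_of_charTwo`).  Junk value `K̄^{Γ_K}`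
(`= K` in characteristic `0`) when `ρ̄` is not of dihedral type.
[cite: Allen2014, Introduction, Theorem, hypothesis (5)] -/
def residualQuadraticField (ρ : absoluteGaloisGroup K →* GL n R) :
    IntermediateField K (AlgebraicClosure K) :=
  IntermediateField.fixedField (dihedralRotationSubgroup (G := absoluteGaloisGroup K) ρ)

/-- Unfolding lemma for `residualQuadraticField` (the subgroup is taken in
`Γ_K = Field.absoluteGaloisGroup K`, Mathlib's non-reducible synonym of `K̄ ≃ₐ[K] K̄`).
[folklore] -/
theorem residualQuadraticField_def (ρ : absoluteGaloisGroup K →* GL n R) :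
    residualQuadraticField ρ =
      IntermediateField.fixedField (dihedralRotationSubgroup (G := absoluteGaloisGroup K) ρ) :=
  rfl

/-- Elements of `dihedralRotationSubgroup ρ̄` fix `residualQuadraticField ρ̄` pointwise.
[folklore] -/
theorem smul_eq_self_of_mem_dihedralRotationSubgroup {ρ : absoluteGaloisGroup K →* GL n R}
    {σ : absoluteGaloisGroup K} (hσ : σ ∈ dihedralRotationSubgroup ρ)
    (x : residualQuadraticField ρ) : σ • (x : AlgebraicClosure K) = x :=
  x.2 ⟨σ, hσ⟩

variable [CharZero K]

/-- **`Gal(K̄/L) = dihedralRotationSubgroup ρ̄`** for `L = residualQuadraticField ρ̄`, when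
`ker ρ̄` is open (Krull's correspondence for open subgroups). [folklore] -/
theorem fixingSubgroup_residualQuadraticField {ρ : absoluteGaloisGroup K →* GL n R}
    (hker : IsOpen (ρ.ker : Set (absoluteGaloisGroup K))) :
    ((residualQuadraticField ρ).fixingSubgroup : Subgroup (absoluteGaloisGroup K)) =
      dihedralRotationSubgroup ρ :=
  fixingSubgroup_fixedField_of_isOpen _ (isOpen_dihedralRotationSubgroup ρ hker)

/-- `residualQuadraticField ρ̄` is a finite extension of `K` (open kernel). [folklore] -/
theorem finiteDimensional_residualQuadraticField {ρ : absoluteGaloisGroup K →* GL n R}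
    (hker : IsOpen (ρ.ker : Set (absoluteGaloisGroup K))) :
    FiniteDimensional K (residualQuadraticField ρ) :=
  finiteDimensional_fixedField_of_isOpen _ (isOpen_dihedralRotationSubgroup ρ hker)

/-- **`[L : K] = 2`** for `L = residualQuadraticField ρ̄`, `ρ̄` of dihedral type with open kernel.
[cite: Allen2014, Introduction, Theorem, hypothesis (5)] -/
theorem finrank_residualQuadraticField {ρ : absoluteGaloisGroup K →* GL n R}
    (h : IsDihedralType ρ) (hker : IsOpen (ρ.ker : Set (absoluteGaloisGroup K))) :
    Module.finrank K (residualQuadraticField ρ) = 2 := by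
  rw [residualQuadraticField_def, finrank_fixedField_of_isOpen _
    (isOpen_dihedralRotationSubgroup ρ hker), h.index_dihedralRotationSubgroup]

/-- `L = residualQuadraticField ρ̄` is a quadratic extension of `K` (Mathlib
`IsQuadraticExtension`). [folklore] -/
theorem isQuadraticExtension_residualQuadraticField {ρ : absoluteGaloisGroup K →* GL n R}
    (h : IsDihedralType ρ) (hker : IsOpen (ρ.ker : Set (absoluteGaloisGroup K))) :
    Algebra.IsQuadraticExtension K (residualQuadraticField ρ) :=
  { finrank_eq_two' := finrank_residualQuadraticField h hker }

/-- **`ρ̄|_{Gal(K̄/L)}` has commutative image** for `L = residualQuadraticField ρ̄` ("the quadratic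
extension such that `ρ̄|_{G_L}` is abelian").
[cite: Allen2014, Introduction, Theorem, hypothesis (5)] -/
theorem commute_of_mem_fixingSubgroup_residualQuadraticField
    {ρ : absoluteGaloisGroup K →* GL n R} (h : IsDihedralType ρ)
    (hker : IsOpen (ρ.ker : Set (absoluteGaloisGroup K))) {σ τ : absoluteGaloisGroup K}
    (hσ : σ ∈ ((residualQuadraticField ρ).fixingSubgroup : Subgroup (absoluteGaloisGroup K)))
    (hτ : τ ∈ ((residualQuadraticField ρ).fixingSubgroup : Subgroup (absoluteGaloisGroup K))) :
    Commute (ρ σ) (ρ τ) := by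
  rw [fixingSubgroup_residualQuadraticField hker] at hσ hτ
  exact h.commute_of_mem_dihedralRotationSubgroup hσ hτ

/-- **`Γ_L ↪ Γ_K` has image `dihedralRotationSubgroup ρ̄`** for `L = residualQuadraticField ρ̄`
(the tree's restriction map `Literature.NumberTheory.GaloisRepresentations.absGaloisRestrict K L`
along a chosen `K̄ ≅ L̄`; its image is a conjugate of `Gal(K̄/L)`, which is normal). [folklore] -/
theorem range_absGaloisRestrict_residualQuadraticField {ρ : absoluteGaloisGroup K →* GL n R}
    (h : IsDihedralType ρ) (hker : IsOpen (ρ.ker : Set (absoluteGaloisGroup K))) :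
    (absGaloisRestrict K (residualQuadraticField ρ)).range = dihedralRotationSubgroup ρ := by
  obtain ⟨g, hg⟩ := exists_mem_range_absGaloisRestrict_fixedField_iff
    (dihedralRotationSubgroup ρ) (isOpen_dihedralRotationSubgroup ρ hker)
  haveI := h.normal_dihedralRotationSubgroup
  ext γ
  rw [residualQuadraticField_def, hg γ]
  constructor
  · intro hmem
    have := (h.normal_dihedralRotationSubgroup).conj_mem _ hmem g
    rwa [show g * (g⁻¹ * γ * g) * g⁻¹ = γ by group] at this
  · intro hmem
    have := (h.normal_dihedralRotationSubgroup).conj_mem _ hmem g⁻¹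
    rwa [inv_inv] at this

/-- **`ρ̄|_{Γ_L}` has commutative image**, restriction along `Γ_L → Γ_K`
(`absGaloisRestrict`), for `L = residualQuadraticField ρ̄`.
[cite: Allen2014, Introduction, Theorem, hypothesis (5)] -/
theorem commute_absGaloisRestrict_residualQuadraticField {ρ : absoluteGaloisGroup K →* GL n R}
    (h : IsDihedralType ρ) (hker : IsOpen (ρ.ker : Set (absoluteGaloisGroup K)))
    (x y : absoluteGaloisGroup (residualQuadraticField ρ)) :
    Commute (ρ (absGaloisRestrict K (residualQuadraticField ρ) x))
      (ρ (absGaloisRestrict K (residualQuadraticField ρ) y)) :=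
  h.commute_of_mem_dihedralRotationSubgroup
    ((range_absGaloisRestrict_residualQuadraticField h hker).le ⟨x, rfl⟩)
    ((range_absGaloisRestrict_residualQuadraticField h hker).le ⟨y, rfl⟩)

/-- The fixing subgroup of a quadratic subfield of `K̄` has index `2` in `Γ_K`. [folklore] -/
theorem index_fixingSubgroup_of_finrank_eq {L' : IntermediateField K (AlgebraicClosure K)} {d : ℕ}
    (hL' : Module.finrank K L' = d) :
    (L'.fixingSubgroup : Subgroup (absoluteGaloisGroup K)).index = d := by
  have h1 := IntermediateField.finrank_eq_fixingSubgroup_index L'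
  rw [hL'] at h1
  exact h1.symm

/-- **Uniqueness of the residual quadratic field** (`k` algebraically closed, any
characteristic): for `ρ̄ : Γ_K → GL₂(k)` with finite image, no common eigenvector, of dihedral
type with `|\bar ρ̄(Γ_K)| > 4`, a quadratic subfield `L' ⊆ K̄` of `K` such that `ρ̄(Gal(K̄/L'))` is
commutative is `residualQuadraticField ρ̄`.
[cite: Allen2014, Introduction, paragraph before the Theorem] -/
theorem eq_residualQuadraticField {k : Type*} [Field k] [IsAlgClosed k]
    {ρ : absoluteGaloisGroup K →* GL (Fin 2) k} [Finite ρ.range] (hρ : IsDihedralType ρ)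
    (hce : ¬ HasCommonEigenvector ρ) (h4 : 4 < Nat.card (projectiveImage ρ))
    {L' : IntermediateField K (AlgebraicClosure K)} (hL' : Module.finrank K L' = 2)
    (hc' : ∀ σ ∈ (L'.fixingSubgroup : Subgroup (absoluteGaloisGroup K)),
      ∀ τ ∈ (L'.fixingSubgroup : Subgroup (absoluteGaloisGroup K)), Commute (ρ σ) (ρ τ)) :
    L' = residualQuadraticField ρ := by
  have hH := hρ.eq_dihedralRotationSubgroup hce h4 (index_fixingSubgroup_of_finrank_eq hL') hc'
  rw [residualQuadraticField_def, ← hH]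
  exact (InfiniteGalois.fixedField_fixingSubgroup L').symm

/-- **Uniqueness of the residual quadratic field in characteristic `2`** (Allen 2014: "the
extension `L/F` in assumption (5) is unique since … the image of a mod `2` dihedral
representation has order not divisible by `4`"): `k` algebraically closed of characteristic `2`,
`ρ̄ : Γ_K → GL₂(k)` with finite image, no common eigenvector, of dihedral type; a quadratic
`L' ⊆ K̄` with `ρ̄(Gal(K̄/L'))` commutative is `residualQuadraticField ρ̄`.
[cite: Allen2014, Introduction, paragraph before the Theorem] -/
theorem eq_residualQuadraticField_of_charTwo {k : Type*} [Field k] [IsAlgClosed k] [CharP k 2]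
    {ρ : absoluteGaloisGroup K →* GL (Fin 2) k} [Finite ρ.range] (hρ : IsDihedralType ρ)
    (hce : ¬ HasCommonEigenvector ρ)
    {L' : IntermediateField K (AlgebraicClosure K)} (hL' : Module.finrank K L' = 2)
    (hc' : ∀ σ ∈ (L'.fixingSubgroup : Subgroup (absoluteGaloisGroup K)),
      ∀ τ ∈ (L'.fixingSubgroup : Subgroup (absoluteGaloisGroup K)), Commute (ρ σ) (ρ τ)) :
    L' = residualQuadraticField ρ :=
  eq_residualQuadraticField hρ hce (hρ.four_lt_card_projectiveImage_of_charTwo hce) hL' hc'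

/-- Uniqueness of the residual quadratic field in characteristic `0` (`|\bar ρ̄(Γ_K)| > 4`).
[folklore] -/
theorem eq_residualQuadraticField_of_charZero {k : Type*} [Field k] [IsAlgClosed k] [CharZero k]
    {ρ : absoluteGaloisGroup K →* GL (Fin 2) k} [Finite ρ.range] (hρ : IsDihedralType ρ)
    (h4 : 4 < Nat.card (projectiveImage ρ))
    {L' : IntermediateField K (AlgebraicClosure K)} (hL' : Module.finrank K L' = 2)
    (hc' : ∀ σ ∈ (L'.fixingSubgroup : Subgroup (absoluteGaloisGroup K)),
      ∀ τ ∈ (L'.fixingSubgroup : Subgroup (absoluteGaloisGroup K)), Commute (ρ σ) (ρ τ)) :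
    L' = residualQuadraticField ρ :=
  eq_residualQuadraticField hρ hρ.not_hasCommonEigenvector h4 hL' hc'

end ResidualField

/-! ### Allen's condition (5) -/

section Allen

open NumberField IsDedekindDomain

variable {K : Type*} [Field K] {n : Type*} [Fintype n] [DecidableEq n] {R : Type*} [CommRing R]

/-- **Allen's condition (5)** (P. Allen, Compositio Math. 150 (2014), Theorem of the
Introduction, hypothesis (5), for a totally real `F` and `ρ̄ : G_F → GL₂(𝔽̄₂)` absolutely
irreducible with solvable — hence dihedral — image): "letting `L/F` denote the unique quadratic
extension such that `ρ̄|_{G_L}` is abelian, if `L/F` is CM, then there is some `v ∣ 2` in `F`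
that does not split in `L`."  Here `L = residualQuadraticField ρ̄ ⊆ K̄`; "`L/K` is CM" is
rendered as "`L` is totally complex" (for `K` totally real and `[L : K] = 2` this is what a CM
extension `L/K` means, Mathlib `NumberField.IsCMField`, `NumberField.CMExtension`), and "`v`
does not split in `L`" as "at most one prime of `𝓞_L` lies over `v`" (for the quadratic `L/K`:
`v` is inert or ramified in `L`; Mathlib `Ideal.primesOver`).  Allen, p. 2: the condition "is
related to the fact that when the extension `L/F` is CM and every `v ∣ 2` in `F` splits in `L`,
Hida's universal nearly ordinary Hecke algebra has CM components".
[cite: Allen2014, Introduction, Theorem, hypothesis (5)] -/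
def AllenConditionFive (ρ : absoluteGaloisGroup K →* GL n R) : Prop :=
  IsTotallyComplex (residualQuadraticField ρ) →
    ∃ v : HeightOneSpectrum (𝓞 K), ((2 : ℕ) : 𝓞 K) ∈ v.asIdeal ∧
      (v.asIdeal.primesOver (𝓞 (residualQuadraticField ρ))).Subsingleton

/-- Unfolding lemma for `AllenConditionFive`. [folklore] -/
theorem allenConditionFive_iff (ρ : absoluteGaloisGroup K →* GL n R) :
    AllenConditionFive ρ ↔
      (IsTotallyComplex (residualQuadraticField ρ) →
        ∃ v : HeightOneSpectrum (𝓞 K), ((2 : ℕ) : 𝓞 K) ∈ v.asIdeal ∧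
          (v.asIdeal.primesOver (𝓞 (residualQuadraticField ρ))).Subsingleton) :=
  Iff.rfl

/-- Condition (5) holds when `L` is not totally complex ("`L/F` is not CM"). [folklore] -/
theorem AllenConditionFive.of_not_isTotallyComplex {ρ : absoluteGaloisGroup K →* GL n R}
    (h : ¬ IsTotallyComplex (residualQuadraticField ρ)) : AllenConditionFive ρ :=
  fun h' => absurd h' h

/-- Condition (5) holds when some `v ∣ 2` of `K` does not split in `L`. [folklore] -/
theorem AllenConditionFive.of_exists {ρ : absoluteGaloisGroup K →* GL n R}
    (h : ∃ v : HeightOneSpectrum (𝓞 K), ((2 : ℕ) : 𝓞 K) ∈ v.asIdeal ∧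
      (v.asIdeal.primesOver (𝓞 (residualQuadraticField ρ))).Subsingleton) :
    AllenConditionFive ρ :=
  fun _ => h

/-- Condition (5) holds when `L` is totally real (a field with an infinite place is not both
totally real and totally complex; `L`, finite over the number field `K` when `ker ρ̄` is open,
has one). [folklore] -/
theorem AllenConditionFive.of_isTotallyReal [NumberField K]
    {ρ : absoluteGaloisGroup K →* GL n R} (hker : IsOpen (ρ.ker : Set (absoluteGaloisGroup K)))
    (h : IsTotallyReal (residualQuadraticField ρ)) : AllenConditionFive ρ := by
  intro hc
  haveI : FiniteDimensional K (residualQuadraticField ρ) :=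
    finiteDimensional_residualQuadraticField hker
  haveI : NumberField (residualQuadraticField ρ) := NumberField.of_module_finite K _
  obtain ⟨w⟩ := (inferInstance : Nonempty (InfinitePlace (residualQuadraticField ρ)))
  exact absurd (h.isReal w) (InfinitePlace.not_isReal_iff_isComplex.mpr (hc.isComplex w))

end Allen

end Literature.NumberTheory.GaloisRepresentations
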